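import Summits.QuantumFields.BalabanUV.Beta.GAN24.FineReadoutCauchyOfParts
import Summits.QuantumFields.BalabanUV.Beta.GAN24.FineReadoutCauchyReal

/-!
# `BalabanUV.Beta.GAN24.FineReadoutCauchy` — «(N1-Cauchy)» AT `d = 3` FROM THE MATCHED-LABEL BOUND: the END of the holder's chain

**G-an2-4 FORMALISATION SWARM, b2b-balaban-gan24-formalise-leaf-17 (gen 11) — the END module of the located leaf «(N1-Cauchy)»** (owner's
typed spec `HOME/b2b-balaban-gan24-p1/N1-CAUCHY-SPEC.md` §1; division `HOME/b2b-balaban-gan24-formalise-leaf-17/g11/N1-CAUCHY-DIVISION.md`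
v2.1, the team table of record: F/N/S₀/S1/S2 leaf-17, A leaf-16, K leaf-01, C + Real leaf-13).  NOT IN PRINT; OUR PROOF ATTEMPT.  [folklore]
composition, no analysis of its own.

HONEST FRAMING (verbatim): «discharging `BetaPertH` makes Bałaban's UV stability UNCONDITIONAL — a real constructive-QFT result;
it is NOT the continuum limit and NOT the Clay problem.»
HONEST DEPENDENCY (verbatim): «continuum YM on T⁴ ⇐ BetaPertH ∧ nine spine estimates (0/9 proved); BetaPertH ⇐ (D1) ∧ (D4) ∧ CAP+tail;
G-an2-4 gates asym, D1 and NE2/3/4.»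

## What is here
**`exists_wH_cellMean_cauchy_of_matched (hLc : 2 ≤ Lc) (hcA : 0 ≤ c_A) (hA)`**: the owner's «(N1-Cauchy)» §1 at `d = 3` VERBATIM
(`∃ c θ κ₁, 0 ≤ c ∧ 0 ≤ θ ∧ θ < 1 ∧ 0 < κ₁ ∧ ∀ n κ l z, |(Lc^4)⁻¹·Σ_{r ∈ box 4 Lc} (Lc^(n+2))^5·wH_{Lc^(n+2)} κ l (Lc•z + r) − (Lc^(n+1))^5·wH_{Lc^(n+1)} κ l z| ≤ c·θ^n·e^{−κ₁|quo z|₁}`)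
from ONE hypothesis `hA` = PART A's matched-label bound at real momenta `q ∈ BZ ∖ {0}` (leaf-16's `GAN24/FineReadoutCauchyAmp*`), by
`FineReadoutCauchyOfParts.realRate_of_matched` (S2: + leaf-01's new-label tail + closure at `q = 0`, θ = Lc⁻¹) and leaf-13's real-zone
assembly `FineReadoutCauchyReal.exists_wH_cellMean_cauchy_three_of_realRate` ((N1) `FineReadoutDecay.exists_wH_decay` + King's geometric
mean: witnesses `(√(2C·c), √(Lc⁻¹), κ₀/8)`).  When PART A lands, `hA` is a tree theorem and «(N1-Cauchy)» is unconditional (one `exact`).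
Discharges NOTHING of `(hS, hSall)` by itself; it is the located input of the five DIFF rows of `StencilSlotE3RateOfPieces`.  0 sorry,
axioms {propext, Classical.choice, Quot.sound}.
-/

noncomputable section

open Complex Finset
open scoped Real BigOperators
open Literature.MathematicalPhysics.QuantumFieldTheory
open Literature.MathematicalPhysics.QuantumFieldTheory.Balaban1983to89
open Literature.MathematicalPhysics.QuantumFieldTheory.Balaban1983to89.Beta
open Literature.Probability.LatticeModels (Site TorusSite Torus.proj)
open LatticeForm (repZ quo)
open B12Sec2to5 (l1)
open B4Strip (ofRealVec)
open B4ContourShift (BZ)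
open BlochFibreMatrix (Idx)
open AffineAveraging (box toSite)
open KernelSpecInstance (wH)
open Summit.QuantumFields.BalabanUV.Beta.GAN24.CombesThomasFibre (fibInv)
open Summit.QuantumFields.BalabanUV.Beta.GAN24.FibreSymbols (pw)
open Summit.QuantumFields.BalabanUV.Beta.GAN24.FibreDFT (kFine)
open Summit.QuantumFields.BalabanUV.Beta.GAN24.FibreDFTDictionary (ampA)
open Summit.QuantumFields.BalabanUV.Beta.GAN24.AliasReindex (lift)
open Summit.QuantumFields.BalabanUV.Beta.GAN24.FineReadoutCauchyFold (boxW)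
open Summit.QuantumFields.BalabanUV.Beta.GAN24.FineReadoutCauchyOfParts (realRate_of_matched)
open Summit.QuantumFields.BalabanUV.Beta.GAN24.FineReadoutCauchyReal (exists_wH_cellMean_cauchy_three_of_realRate)

namespace Summit.QuantumFields.BalabanUV.Beta.GAN24.FineReadoutCauchy

/-- [folklore] **«(N1-Cauchy)» AT `d = 3` FROM THE MATCHED-LABEL BOUND** (every `Lc ≥ 2`): the `Lc`-cell means of the next level's
normalised fine minimiser column converge to this level's column geometrically in the member with exponential block decay — the owner's
`N1-CAUCHY-SPEC.md` §1 VERBATIM — as soon as the matched-label terms of the glue identity sum to `≤ c_A·Lc^{−(n+1)}` at every real momentum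
off zero (PART A).  Inputs BY NAME: S2 `realRate_of_matched` (new-label tail `FineReadoutCauchyTail`, closure at zero) and the real-zone
assembly `FineReadoutCauchyReal.exists_wH_cellMean_cauchy_three_of_realRate` ((N1) + geometric mean). -/
theorem exists_wH_cellMean_cauchy_of_matched (Lc : ℕ) [NeZero Lc] (hLc : 2 ≤ Lc) {cA : ℝ} (hcA : 0 ≤ cA)
    (hA : ∀ (n : ℕ) (κ l : Fin (3 + 1)) (z : Site (3 + 1)) (q : Fin (3 + 1) → ℝ), q ∈ BZ (3 + 1) → q ≠ 0 →
      ∑ m : TorusSite (3 + 1) (Lc ^ (n + 1)),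
        ‖(((Lc : ℂ) ^ (3 + 1))⁻¹ * (((Lc ^ (n + 2) : ℕ) : ℂ) ^ (3 + 2)) *
            (boxW Lc (kFine (ofRealVec q) (lift (Lc ^ (n + 2)) m)) *
              ampA (ofRealVec q) (fun i => fibInv (Lc ^ (n + 2)) i (Sum.inr (Sum.inr l)) (ofRealVec q)) (lift (Lc ^ (n + 2)) m) κ) -
          (((Lc ^ (n + 1) : ℕ) : ℂ) ^ (3 + 2)) *
            ampA (ofRealVec q) (fun i => fibInv (Lc ^ (n + 1)) i (Sum.inr (Sum.inr l)) (ofRealVec q)) m κ)‖ ≤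
        cA * ((Lc : ℝ)⁻¹) ^ (n + 1)) :
    ∃ c θ κ₁ : ℝ, 0 ≤ c ∧ 0 ≤ θ ∧ θ < 1 ∧ 0 < κ₁ ∧ ∀ (n : ℕ) (κ l : Fin 4) (z : Fin 4 → ℤ),
      |((Lc : ℝ) ^ (3 + 1))⁻¹ * ∑ r ∈ box (3 + 1) Lc,
            ((Lc : ℝ) ^ (n + 2)) ^ (3 + 2) * wH (N := Lc ^ (n + 2)) κ l ((Lc : ℤ) • z + toSite r) -
          ((Lc : ℝ) ^ (n + 1)) ^ (3 + 2) * wH (N := Lc ^ (n + 1)) κ l z| ≤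
        c * θ ^ n * Real.exp (-κ₁ * l1 (quo (Lc ^ (n + 1)) z)) := by
  obtain ⟨c, hc, hR⟩ := realRate_of_matched Lc hcA hA
  have hLc1 : (1 : ℝ) < Lc := by exact_mod_cast hLc
  have hθ0 : (0 : ℝ) ≤ (Lc : ℝ)⁻¹ := by positivity
  have hθ1 : (Lc : ℝ)⁻¹ < 1 := inv_lt_one_of_one_lt₀ hLc1
  exact exists_wH_cellMean_cauchy_three_of_realRate Lc hc hθ0 hθ1 hR

end Summit.QuantumFields.BalabanUV.Beta.GAN24.FineReadoutCauchy

end
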